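import Mathlib.Data.Fintype.BigOperators
import Mathlib.Data.Fintype.CardEmbedding
import Mathlib.Data.Fin.Tuple.Finset
import Mathlib.Data.Nat.Squarefree
import Mathlib.Algebra.Squarefree.Basic
import Mathlib.Data.Complex.Basic
import Mathlib.Algebra.BigOperators.Field
import Mathlib.Analysis.PSeries
import Mathlib.Analysis.SpecialFunctions.Pow.Real
import HarnessLib

/-!
# Ford's counterexamples to a fixed-level asymptotic sieve: ordered tuples of primes vs. subsets

Topic `Literature/NumberTheory/Sieve`, companion of `FordAsymptoticSieve.lean` (the named fact
`Literature.NumberTheory.Sieve.Ford2004_localConstruction` = [Ford2004] Theorem 3 with the choice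
of `f_{1_M}` of the proof of Theorem 1). Source: K. Ford, *On Bombieri's asymptotic sieve*, Trans.
Amer. Math. Soc. **357** (2005) 1663–1674 (arXiv math/0401215) [Ford2004], §3.

[Ford2004] §3 silently identifies a squarefree `n = p_1⋯p_r ∈ 𝒞_α` with its ordered
factorisations (the factor `1/r!` in (3.11)) and ignores coincidences `p_i = p_j`; the divisor
condition `d ∣ n`, `d ∈ 𝒟_β`, is resolved by splitting off the primes of `d` ((3.3)–(3.4)).
This file PROVES the finite combinatorics that makes these steps honest in the tree's
formalisation of Theorem 3 (where `b_n` is a sum over SETS `s` of primes with `∏ s = n` and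
Lemma 2.2, `Ford2004.primeSum_est`, is about ORDERED tuples):

* `Ford2004.sum_filter_injective_eq` — summing a function of the image over the injective
  `r`-tuples with values in `P` counts each `r`-subset exactly `r!` times
  (`card_filter_piFinset_injective`: there are `|s|(|s|−1)⋯(|s|−r+1)` injective `Fin r → s`);
* `Ford2004.card_nonInj_le` — the non-injective `r`-tuples of primes `≥ z` with product in a
  window `(y, y']` number `≤ r^r (2(y'−y+1)/z + √y' + 1)` (each has `p² ∣ ∏` for a prime
  `p ≥ z`, fibres of `u ↦ ∏ u` have `≤ r^r` elements, multiples of `p²` are counted);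
* `Ford2004.sum_powerset_filter_dvd` — the divisor structure: `∑_{s ⊆ P, d ∣ ∏s, J(∏s)} w(s)`
  factors through the prime factors `t₀` of `d` (squarefree, `t₀ ⊆ P`; zero otherwise) as
  `w(t₀) · ∑_{t ⊆ P∖t₀, J(d∏t)} w(t)`; `card_powerset_filter_mem_le` (sets through a given prime
  with product in a window are at most the multiples of that prime there); `sum_piFinset_succ`
  (peeling off the first coordinate of a tuple sum).

Everything here is a theorem over Mathlib only (no definitions, no named facts).

## References

* K. Ford, *On Bombieri's asymptotic sieve*, Trans. AMS 357 (2005), 1663–1674, §3, (3.3)–(3.4),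
  (3.11) [Ford2004].
-/

open Finset

namespace Literature.NumberTheory.Sieve.Ford2004

/-! ### Ordered tuples: peeling off the first coordinate -/

/-- `∑_{u : Fin (r+1) → P} f(u) = ∑_{p ∈ P} ∑_{u' : Fin r → P} f(p :: u')`. [folklore] -/
theorem sum_piFinset_succ {M : Type*} [AddCommMonoid M] (P : Finset ℕ) (r : ℕ)
    (f : (Fin (r + 1) → ℕ) → M) :
    ∑ u ∈ Fintype.piFinset (fun _ : Fin (r + 1) => P), f u =
      ∑ p ∈ P, ∑ u ∈ Fintype.piFinset (fun _ : Fin r => P), f (Fin.cons p u) := by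
  rw [← Finset.sum_product']
  refine Finset.sum_equiv ((Fin.consEquiv fun _ => ℕ).symm) ?_ ?_
  · intro u
    simp [Fintype.mem_piFinset, Fin.forall_fin_succ, Fin.consEquiv, Fin.tail]
  · intro u _
    simp [Fin.consEquiv]

/-- The tuple space over `Fin 0` is the singleton `univ`. [folklore] -/
theorem piFinset_fin_zero (P : Finset ℕ) : Fintype.piFinset (fun _ : Fin 0 => P) = Finset.univ := by
  ext u; simp

/-! ### Injective tuples versus subsets: the `r!`-to-one correspondence -/

/-- The number of injective maps `Fin r → s` (as a finset of functions `Fin r → ℕ` with values in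
`s`) is `|s| (|s|−1) ⋯ (|s|−r+1)`. [folklore] -/
theorem card_filter_piFinset_injective (s : Finset ℕ) (r : ℕ) :
    ((Fintype.piFinset fun _ : Fin r => s).filter (fun u => Function.Injective u)).card =
      s.card.descFactorial r := by
  classical
  set T := (Fintype.piFinset fun _ : Fin r => s).filter (fun u => Function.Injective u) with hT
  have hmem : ∀ u, u ∈ T ↔ (∀ i, u i ∈ s) ∧ Function.Injective u := fun u => by
    rw [hT, Finset.mem_filter, Fintype.mem_piFinset]
  let e : {u // u ∈ T} ≃ (Fin r ↪ {p // p ∈ s}) :=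
    { toFun := fun u => ⟨fun i => ⟨u.1 i, ((hmem u.1).mp u.2).1 i⟩, fun i j h => by
        have := ((hmem u.1).mp u.2).2
        exact this (congrArg Subtype.val h)⟩
      invFun := fun g => ⟨fun i => (g i : ℕ), (hmem _).mpr ⟨fun i => (g i).2, fun i j h =>
        g.injective (Subtype.ext h)⟩⟩
      left_inv := fun u => by ext i; rfl
      right_inv := fun g => by ext i; rfl }
  rw [← Fintype.card_coe T, Fintype.card_congr e, Fintype.card_embedding_eq, Fintype.card_coe,
    Fintype.card_fin]

/-- For an injective tuple the image has `r` elements. [folklore] -/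
theorem card_image_univ_of_injective {r : ℕ} {u : Fin r → ℕ} (hu : Function.Injective u) :
    (Finset.univ.image u).card = r := by
  rw [Finset.card_image_of_injective _ hu, Finset.card_univ, Fintype.card_fin]

/-- The fibre of injective tuples over a given `r`-subset `s` consists exactly of the injective
tuples with values in `s`. [folklore] -/
theorem filter_image_eq (P : Finset ℕ) {r : ℕ} {s : Finset ℕ} (hs : s ∈ P.powersetCard r) :
    ((Fintype.piFinset fun _ : Fin r => P).filter (fun u => Function.Injective u)).filter
        (fun u => Finset.univ.image u = s) =
      (Fintype.piFinset fun _ : Fin r => s).filter (fun u => Function.Injective u) := by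
  classical
  rw [Finset.mem_powersetCard] at hs
  ext u
  simp only [Finset.mem_filter, Fintype.mem_piFinset]
  constructor
  · rintro ⟨⟨_, hinj⟩, himg⟩
    refine ⟨fun i => ?_, hinj⟩
    rw [← himg]; exact Finset.mem_image_of_mem u (Finset.mem_univ i)
  · rintro ⟨hus, hinj⟩
    have hsub : Finset.univ.image u ⊆ s := by
      intro p hp
      obtain ⟨i, _, rfl⟩ := Finset.mem_image.mp hp
      exact hus i
    refine ⟨⟨fun i => hs.1 (hus i), hinj⟩, ?_⟩
    exact Finset.eq_of_subset_of_card_le hsub (by rw [card_image_univ_of_injective hinj, hs.2])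

/-- **Injective tuples versus subsets**: summing a function of the IMAGE over all injective
`r`-tuples with values in `P` counts each `r`-subset of `P` exactly `r!` times. [folklore] -/
theorem sum_filter_injective_eq {M : Type*} [AddCommMonoid M] (P : Finset ℕ) (r : ℕ)
    (F : Finset ℕ → M) :
    ∑ u ∈ (Fintype.piFinset fun _ : Fin r => P).filter (fun u => Function.Injective u),
        F (Finset.univ.image u) =
      r.factorial • ∑ s ∈ P.powersetCard r, F s := by
  classical
  have hmaps : ∀ u ∈ (Fintype.piFinset fun _ : Fin r => P).filter (fun u => Function.Injective u),
      Finset.univ.image u ∈ P.powersetCard r := by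
    intro u hu
    rw [Finset.mem_filter, Fintype.mem_piFinset] at hu
    rw [Finset.mem_powersetCard]
    refine ⟨fun p hp => ?_, card_image_univ_of_injective hu.2⟩
    obtain ⟨i, _, rfl⟩ := Finset.mem_image.mp hp
    exact hu.1 i
  rw [← Finset.sum_fiberwise_of_maps_to hmaps, Finset.smul_sum]
  refine Finset.sum_congr rfl fun s hs => ?_
  have h1 : ∑ u ∈ ((Fintype.piFinset fun _ : Fin r => P).filter (fun u => Function.Injective u)).filter
      (fun u => Finset.univ.image u = s), F (Finset.univ.image u) =
      ∑ u ∈ ((Fintype.piFinset fun _ : Fin r => P).filter (fun u => Function.Injective u)).filter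
      (fun u => Finset.univ.image u = s), F s :=
    Finset.sum_congr rfl fun u hu => by rw [(Finset.mem_filter.mp hu).2]
  rw [h1, Finset.sum_const, filter_image_eq P hs, card_filter_piFinset_injective,
    (Finset.mem_powersetCard.mp hs).2, Nat.descFactorial_self]

/-- For an injective tuple, products over the image are products over the index set. [folklore] -/
theorem prod_image_univ_of_injective {M : Type*} [CommMonoid M] {r : ℕ} {u : Fin r → ℕ}
    (hu : Function.Injective u) (g : ℕ → M) : ∏ p ∈ Finset.univ.image u, g p = ∏ i, g (u i) := by
  classical
  rw [Finset.prod_image fun i _ j _ h => hu h]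

/-! ### Non-injective tuples of primes: counting -/

/-- A non-injective tuple of primes has a repeated prime whose square divides the product.
[folklore] -/
theorem exists_sq_dvd_prod_of_not_injective {r : ℕ} {u : Fin r → ℕ} (hu : ¬ Function.Injective u) :
    ∃ i, u i ^ 2 ∣ ∏ k, u k := by
  classical
  rw [Function.Injective] at hu
  push Not at hu
  obtain ⟨i, j, hij, hne⟩ := hu
  refine ⟨i, ?_⟩
  rw [← Finset.prod_erase_mul _ _ (Finset.mem_univ i), sq]
  refine mul_dvd_mul ?_ dvd_rfl
  rw [hij]
  exact Finset.dvd_prod_of_mem _ (Finset.mem_erase.mpr ⟨Ne.symm hne, Finset.mem_univ j⟩)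

/-- All entries of a tuple of primes with product `n ≠ 0` are prime factors of `n`. [folklore] -/
theorem mem_primeFactors_of_prod_eq {r : ℕ} {u : Fin r → ℕ} (hu : ∀ i, (u i).Prime) {n : ℕ}
    (hn : ∏ k, u k = n) (i : Fin r) : u i ∈ n.primeFactors := by
  have hn0 : n ≠ 0 := by
    rw [← hn]; exact Finset.prod_ne_zero_iff.mpr fun k _ => (hu k).ne_zero
  exact Nat.mem_primeFactors.mpr ⟨hu i, hn ▸ Finset.dvd_prod_of_mem _ (Finset.mem_univ i), hn0⟩

/-- The prime factors of the product of a tuple of primes are among its entries. [folklore] -/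
theorem primeFactors_prod_subset_image {r : ℕ} {u : Fin r → ℕ} (hu : ∀ i, (u i).Prime) :
    (∏ k, u k).primeFactors ⊆ Finset.univ.image u := by
  classical
  intro q hq
  obtain ⟨hqp, hqd, _⟩ := Nat.mem_primeFactors.mp hq
  obtain ⟨i, _, hi⟩ := (Prime.dvd_finsetProd_iff hqp.prime _).mp hqd
  rw [Finset.mem_image]
  exact ⟨i, Finset.mem_univ i, ((Nat.prime_dvd_prime_iff_eq hqp (hu i)).mp hi).symm⟩

/-- **Fibres of `u ↦ ∏ u` are small**: at most `r^r` tuples of primes of length `r` have a given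
product. [folklore] -/
theorem card_filter_prod_eq_le (P : Finset ℕ) (hP : ∀ p ∈ P, p.Prime) (r n : ℕ) :
    ((Fintype.piFinset fun _ : Fin r => P).filter (fun u => ∏ k, u k = n)).card ≤ r ^ r := by
  classical
  by_cases hex : ∃ u₀ ∈ Fintype.piFinset (fun _ : Fin r => P), ∏ k, u₀ k = n
  · obtain ⟨u₀, hu₀, hn⟩ := hex
    have hu₀P : ∀ i, (u₀ i).Prime := fun i => hP _ (Fintype.mem_piFinset.mp hu₀ i)
    have hω : n.primeFactors.card ≤ r := by
      rw [← hn]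
      refine (Finset.card_le_card (primeFactors_prod_subset_image hu₀P)).trans ?_
      exact Finset.card_image_le.trans (by simp)
    calc ((Fintype.piFinset fun _ : Fin r => P).filter (fun u => ∏ k, u k = n)).card
        ≤ (Fintype.piFinset fun _ : Fin r => n.primeFactors).card := by
          refine Finset.card_le_card fun u hu => ?_
          rw [Finset.mem_filter, Fintype.mem_piFinset] at hu
          exact Fintype.mem_piFinset.mpr (mem_primeFactors_of_prod_eq (fun i => hP _ (hu.1 i)) hu.2)
      _ = n.primeFactors.card ^ r := by rw [Fintype.card_piFinset, Finset.prod_const, Finset.card_univ, Fintype.card_fin]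
      _ ≤ r ^ r := Nat.pow_le_pow_left hω r
  · push Not at hex
    rw [Finset.filter_eq_empty_iff.mpr fun u hu h => hex u hu h, Finset.card_empty]
    exact Nat.zero_le _

/-- Multiples of `k` in `(a, b]` (`a ≤ b`): exactly `b/k − a/k`. [folklore] -/
theorem card_multiples_Ioc (a b k : ℕ) (hab : a ≤ b) :
    ((Finset.Ioc a b).filter (fun m => k ∣ m)).card = b / k - a / k := by
  have h1 : (Finset.Ioc a b).filter (fun m => k ∣ m) =
      ((Finset.Ioc 0 b).filter (fun m => k ∣ m)) \ ((Finset.Ioc 0 a).filter (fun m => k ∣ m)) := by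
    ext m
    simp only [Finset.mem_sdiff, Finset.mem_filter, Finset.mem_Ioc]
    constructor
    · rintro ⟨⟨h1, h2⟩, h3⟩; exact ⟨⟨⟨by omega, h2⟩, h3⟩, fun h => by omega⟩
    · rintro ⟨⟨⟨h1, h2⟩, h3⟩, h4⟩
      refine ⟨⟨?_, h2⟩, h3⟩
      by_contra h5
      exact h4 ⟨⟨h1, by omega⟩, h3⟩
  have hsub : (Finset.Ioc 0 a).filter (fun m => k ∣ m) ⊆ (Finset.Ioc 0 b).filter (fun m => k ∣ m) := by
    intro m hm
    simp only [Finset.mem_filter, Finset.mem_Ioc] at hm ⊢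
    exact ⟨⟨hm.1.1, hm.1.2.trans hab⟩, hm.2⟩
  rw [h1, Finset.card_sdiff_of_subset hsub, Nat.Ioc_filter_dvd_card_eq_div, Nat.Ioc_filter_dvd_card_eq_div]

/-- Multiples of `k ≥ 1` in `(a, b]` (`a ≤ b`): at most `(b − a)/k + 1`. [folklore] -/
theorem card_multiples_Ioc_le (a b k : ℕ) (hab : a ≤ b) (hk : 0 < k) :
    (((Finset.Ioc a b).filter (fun m => k ∣ m)).card : ℝ) ≤ ((b : ℝ) - a) / k + 1 := by
  rw [card_multiples_Ioc a b k hab]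
  have hk' : (0 : ℝ) < k := by exact_mod_cast hk
  have hle : a / k ≤ b / k := Nat.div_le_div_right hab
  rw [Nat.cast_sub hle]
  have hbk : ((b / k : ℕ) : ℝ) ≤ (b : ℝ) / k := Nat.cast_div_le
  have hak : (a : ℝ) / k - 1 ≤ ((a / k : ℕ) : ℝ) := by
    have h := Nat.lt_div_mul_add hk (a := a)
    have h' : (a : ℝ) < ((a / k : ℕ) : ℝ) * k + k := by exact_mod_cast h
    rw [sub_le_iff_le_add, div_le_iff₀ hk']
    linarith
  rw [sub_div]
  linarith

/-- `∑_{z ≤ p ≤ N} 1/p² ≤ 2/z` for `z ≥ 1` (over all integers, a fortiori over primes). [folklore] -/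
theorem sum_inv_sq_le {z : ℝ} (hz : 1 ≤ z) (N : ℕ) :
    ∑ p ∈ (Finset.Icc ⌈z⌉₊ N).filter Nat.Prime, (1 / (p : ℝ) ^ 2) ≤ 2 / z := by
  have hz1 : 1 ≤ ⌈z⌉₊ := Nat.one_le_iff_ne_zero.mpr (by
    intro h; rw [Nat.ceil_eq_zero] at h; linarith)
  calc ∑ p ∈ (Finset.Icc ⌈z⌉₊ N).filter Nat.Prime, (1 / (p : ℝ) ^ 2)
      ≤ ∑ p ∈ Finset.Icc ⌈z⌉₊ N, (1 / (p : ℝ) ^ 2) :=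
        Finset.sum_le_sum_of_subset_of_nonneg (Finset.filter_subset _ _) fun i _ _ => by positivity
    _ ≤ ∑ p ∈ Finset.Ioo (⌈z⌉₊ - 1) (N + 1), ((p : ℝ) ^ 2)⁻¹ := by
        simp_rw [one_div]
        refine Finset.sum_le_sum_of_subset_of_nonneg (fun p hp => ?_) fun i _ _ => by positivity
        simp only [Finset.mem_Icc, Finset.mem_Ioo] at hp ⊢
        omega
    _ ≤ 2 / ((⌈z⌉₊ - 1 : ℕ) + 1) := sum_Ioo_inv_sq_le _ _
    _ ≤ 2 / z := by
        rw [Nat.cast_sub hz1, Nat.cast_one, sub_add_cancel]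
        exact div_le_div_of_nonneg_left (by norm_num) (by linarith) (Nat.le_ceil z)

open Classical in
/-- Integers in `(y, y']` divisible by the square of a prime `≥ z ≥ 1`: at most
`2(y' − y + 1)/z + √y' + 1` of them. [folklore] -/
theorem card_badN_le {y y' z : ℝ} (hy : 0 ≤ y) (hyy : y ≤ y') (hz : 1 ≤ z) :
    (((Finset.Ioc ⌊y⌋₊ ⌊y'⌋₊).filter
        (fun n : ℕ => ∃ p : ℕ, p.Prime ∧ z ≤ (p : ℝ) ∧ p ^ 2 ∣ n)).card : ℝ) ≤
      (y' - y + 1) * (2 / z) + (Real.sqrt y' + 1) := by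
  classical
  set Q := (Finset.Icc ⌈z⌉₊ ⌊Real.sqrt y'⌋₊).filter Nat.Prime with hQ
  have hy' : 0 ≤ y' := hy.trans hyy
  -- cover the bad set by the multiples of `p²`, `p ∈ Q`
  have hcover : (Finset.Ioc ⌊y⌋₊ ⌊y'⌋₊).filter (fun n : ℕ => ∃ p : ℕ, p.Prime ∧ z ≤ (p : ℝ) ∧ p ^ 2 ∣ n) ⊆
      Q.biUnion (fun p => (Finset.Ioc ⌊y⌋₊ ⌊y'⌋₊).filter (fun n => p ^ 2 ∣ n)) := by
    intro n hn
    rw [Finset.mem_filter] at hn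
    obtain ⟨hnI, p, hp, hzp, hpn⟩ := hn
    rw [Finset.mem_biUnion]
    refine ⟨p, ?_, Finset.mem_filter.mpr ⟨hnI, hpn⟩⟩
    rw [hQ, Finset.mem_filter, Finset.mem_Icc]
    refine ⟨⟨Nat.ceil_le.mpr hzp, Nat.le_floor ?_⟩, hp⟩
    -- `p² ≤ n ≤ y'`
    have hn2 : (n : ℝ) ≤ y' := by
      have := (Finset.mem_Ioc.mp hnI).2
      have hn0 : n ≠ 0 := by have := (Finset.mem_Ioc.mp hnI).1; omega
      exact (Nat.le_floor_iff' hn0).mp this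
    have hp2 : ((p : ℕ) : ℝ) ^ 2 ≤ n := by
      have hn0 : 0 < n := by have := (Finset.mem_Ioc.mp hnI).1; omega
      exact_mod_cast Nat.le_of_dvd hn0 hpn
    rw [show (p : ℝ) = Real.sqrt ((p : ℝ) ^ 2) by rw [Real.sqrt_sq (Nat.cast_nonneg p)]]
    exact Real.sqrt_le_sqrt (hp2.trans hn2)
  have hfl : ⌊y⌋₊ ≤ ⌊y'⌋₊ := Nat.floor_le_floor hyy
  calc ((((Finset.Ioc ⌊y⌋₊ ⌊y'⌋₊).filter
          (fun n : ℕ => ∃ p : ℕ, p.Prime ∧ z ≤ (p : ℝ) ∧ p ^ 2 ∣ n)).card : ℕ) : ℝ)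
      ≤ ((Q.biUnion (fun p => (Finset.Ioc ⌊y⌋₊ ⌊y'⌋₊).filter (fun n => p ^ 2 ∣ n))).card : ℝ) := by
        exact_mod_cast Finset.card_le_card hcover
    _ ≤ ∑ p ∈ Q, (((Finset.Ioc ⌊y⌋₊ ⌊y'⌋₊).filter (fun n => p ^ 2 ∣ n)).card : ℝ) := by
        exact_mod_cast Finset.card_biUnion_le
    _ ≤ ∑ p ∈ Q, (((⌊y'⌋₊ : ℝ) - ⌊y⌋₊) / (p ^ 2 : ℕ) + 1) := by
        refine Finset.sum_le_sum fun p hp => ?_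
        have hp' : p.Prime := (Finset.mem_filter.mp hp).2
        exact card_multiples_Ioc_le _ _ _ hfl (pow_pos hp'.pos 2)
    _ ≤ ∑ p ∈ Q, ((y' - y + 1) * (1 / (p : ℝ) ^ 2) + 1) := by
        refine Finset.sum_le_sum fun p hp => ?_
        have hp' := (Finset.mem_filter.mp hp).2
        have hp0 : (0 : ℝ) < (p : ℝ) ^ 2 := by have := hp'.pos; positivity
        have h1 : ((⌊y'⌋₊ : ℝ) - ⌊y⌋₊) ≤ y' - y + 1 := by
          have h2 : (⌊y'⌋₊ : ℝ) ≤ y' := Nat.floor_le hy'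
          have h3 : y - 1 < (⌊y⌋₊ : ℝ) := by have := Nat.lt_floor_add_one y; linarith
          linarith
        push_cast
        rw [div_eq_mul_one_div]
        gcongr
    _ = (y' - y + 1) * ∑ p ∈ Q, (1 / (p : ℝ) ^ 2) + Q.card := by
        rw [Finset.sum_add_distrib, Finset.mul_sum, Finset.sum_const, nsmul_eq_mul, mul_one]
    _ ≤ (y' - y + 1) * (2 / z) + (Real.sqrt y' + 1) := by
        have hQsum : ∑ p ∈ Q, (1 / (p : ℝ) ^ 2) ≤ 2 / z := sum_inv_sq_le hz _
        refine add_le_add (mul_le_mul_of_nonneg_left hQsum (by linarith)) ?_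
        · calc (Q.card : ℝ) ≤ ((Finset.Icc ⌈z⌉₊ ⌊Real.sqrt y'⌋₊).card : ℝ) := by
                exact_mod_cast Finset.card_filter_le _ _
            _ ≤ (⌊Real.sqrt y'⌋₊ : ℝ) + 1 := by
                rw [Nat.card_Icc]
                have : ((⌊Real.sqrt y'⌋₊ + 1 - ⌈z⌉₊ : ℕ) : ℝ) ≤ (⌊Real.sqrt y'⌋₊ : ℝ) + 1 := by
                  exact_mod_cast Nat.sub_le _ _
                exact this
            _ ≤ Real.sqrt y' + 1 := by linarith [Nat.floor_le (Real.sqrt_nonneg y')]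

open Classical in
/-- **Few non-injective tuples**: the `r`-tuples of primes `≥ z` with a repeated entry and product
in `(y, y']` number at most `r^r (2(y' − y + 1)/z + √y' + 1)`. [folklore] -/
theorem card_nonInj_le (P : Finset ℕ) (hP : ∀ p ∈ P, p.Prime) (r : ℕ) {y y' z : ℝ} (hy : 0 ≤ y)
    (hyy : y ≤ y') (hz : 1 ≤ z) :
    ((((Fintype.piFinset fun _ : Fin r => P).filter (fun u : Fin r → ℕ => ¬ Function.Injective u ∧
        (y < ∏ i, ((u i : ℕ) : ℝ) ∧ ∏ i, ((u i : ℕ) : ℝ) ≤ y') ∧ ∀ i, z ≤ ((u i : ℕ) : ℝ))).card : ℕ) : ℝ) ≤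
      (r : ℝ) ^ r * ((y' - y + 1) * (2 / z) + (Real.sqrt y' + 1)) := by
  classical
  set Bad := (Fintype.piFinset fun _ : Fin r => P).filter (fun u : Fin r → ℕ => ¬ Function.Injective u ∧
        (y < ∏ i, ((u i : ℕ) : ℝ) ∧ ∏ i, ((u i : ℕ) : ℝ) ≤ y') ∧ ∀ i, z ≤ ((u i : ℕ) : ℝ)) with hBad
  set BadN := (Finset.Ioc ⌊y⌋₊ ⌊y'⌋₊).filter (fun n : ℕ => ∃ p : ℕ, p.Prime ∧ z ≤ (p : ℝ) ∧ p ^ 2 ∣ n) with hBadN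
  -- the product map sends `Bad` into `BadN`
  have himg : Bad.image (fun u => ∏ k, u k) ⊆ BadN := by
    intro n hn
    obtain ⟨u, hu, rfl⟩ := Finset.mem_image.mp hn
    rw [hBad, Finset.mem_filter, Fintype.mem_piFinset] at hu
    obtain ⟨huP, hninj, ⟨h1, h2⟩, hz'⟩ := hu
    have huprime : ∀ i, (u i).Prime := fun i => hP _ (huP i)
    rw [hBadN, Finset.mem_filter, Finset.mem_Ioc]
    have hcast : ((∏ k, u k : ℕ) : ℝ) = ∏ k, (u k : ℝ) := by push_cast; rfl
    refine ⟨⟨?_, ?_⟩, ?_⟩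
    · rw [Nat.floor_lt hy, hcast]; exact h1
    · rw [Nat.le_floor_iff (hy.trans hyy), hcast]; exact h2
    · obtain ⟨i, hi⟩ := exists_sq_dvd_prod_of_not_injective hninj
      exact ⟨u i, huprime i, hz' i, hi⟩
  -- fibres have at most `r^r` elements
  have hfib : ∀ n ∈ Bad.image (fun u => ∏ k, u k), (Bad.filter (fun u => ∏ k, u k = n)).card ≤ r ^ r := by
    intro n _
    refine le_trans (Finset.card_le_card ?_) (card_filter_prod_eq_le P hP r n)
    intro u hu
    rw [Finset.mem_filter] at hu ⊢
    exact ⟨(Finset.mem_filter.mp hu.1).1, hu.2⟩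
  have h1 := Finset.card_le_mul_card_image Bad (r ^ r) hfib
  have h2 := Finset.card_le_card himg
  calc ((Bad.card : ℕ) : ℝ) ≤ ((r ^ r * (Bad.image (fun u => ∏ k, u k)).card : ℕ) : ℝ) := by
        exact_mod_cast h1
    _ ≤ (r : ℝ) ^ r * (BadN.card : ℝ) := by push_cast; gcongr
    _ ≤ (r : ℝ) ^ r * ((y' - y + 1) * (2 / z) + (Real.sqrt y' + 1)) := by
        gcongr
        exact card_badN_le hy hyy hz

/-! ### Squarefree products and divisors: the structure of `{s ⊆ P : d ∣ ∏ s}` -/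

/-- `d ∣ ∏_{p ∈ s} p` (distinct primes) iff `d` is squarefree with all its prime factors in `s`.
[folklore] -/
theorem dvd_prod_primes_iff {s : Finset ℕ} (hs : ∀ p ∈ s, p.Prime) {d : ℕ} :
    d ∣ ∏ p ∈ s, p ↔ Squarefree d ∧ d.primeFactors ⊆ s := by
  have hn0 : ∏ p ∈ s, p ≠ 0 := Finset.prod_ne_zero_iff.mpr fun p hp => (hs p hp).ne_zero
  -- a product of distinct primes is squarefree (also in the tree as
  -- `FriedlanderIwaniecPrimesSquarefree.squarefree_prod_of_primes`, not imported here)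
  have hsqf : Squarefree (∏ p ∈ s, p) := by
    refine Finset.squarefree_prod_of_pairwise_isCoprime ?_ fun p hp => (hs p hp).prime.squarefree
    intro p hp q hq hpq
    exact Nat.coprime_iff_isRelPrime.mp ((Nat.coprime_primes (hs p hp) (hs q hq)).mpr hpq)
  constructor
  · intro h
    refine ⟨hsqf.squarefree_of_dvd h, ?_⟩
    have := Nat.primeFactors_mono h hn0
    rwa [Nat.primeFactors_prod hs] at this
  · rintro ⟨hsq, hsub⟩
    rw [← Nat.prod_primeFactors_of_squarefree hsq]
    exact Finset.prod_dvd_prod_of_subset _ _ _ hsub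

/-- **Divisor structure of subset sums**: for a finite set `P` of primes, weights `w` and a
property `J` of the product, the sum of `∏_{p ∈ s} w(p)` over the `s ⊆ P` with `d ∣ ∏ s` and
`J(∏ s)` factors as `w(t₀) ·` (the same kind of sum over `s' ⊆ P ∖ t₀` with `J(d ∏ s')`),
`t₀` = the prime factors of `d`, when `d` is squarefree with `t₀ ⊆ P`, and vanishes otherwise
(the mechanism `∑_{n ∈ 𝒞_α, d ∣ n} b_n` of [Ford2004] §3, with `d ∈ 𝒟_β`). [folklore] -/
theorem sum_powerset_filter_dvd {M : Type*} [CommRing M] (P : Finset ℕ) (hP : ∀ p ∈ P, p.Prime)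
    (w : ℕ → M) (J : ℕ → Prop) [DecidablePred J] (d : ℕ) :
    ∑ s ∈ P.powerset with (d ∣ ∏ p ∈ s, p ∧ J (∏ p ∈ s, p)), ∏ p ∈ s, w p =
      if Squarefree d ∧ d.primeFactors ⊆ P then
        (∏ p ∈ d.primeFactors, w p) *
          ∑ t ∈ (P \ d.primeFactors).powerset with J (d * ∏ p ∈ t, p), ∏ p ∈ t, w p
      else 0 := by
  classical
  split_ifs with h
  · obtain ⟨hsq, ht₀⟩ := h
    set t₀ := d.primeFactors with ht₀def
    have hd : ∏ p ∈ t₀, p = d := Nat.prod_primeFactors_of_squarefree hsq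
    rw [Finset.mul_sum]
    symm
    refine Finset.sum_nbij' (fun t => t₀ ∪ t) (fun s => s \ t₀) ?_ ?_ ?_ ?_ ?_
    · intro t ht
      rw [Finset.mem_filter, Finset.mem_powerset] at ht ⊢
      obtain ⟨htP, hJ⟩ := ht
      have hdisj : Disjoint t₀ t := Finset.disjoint_of_subset_right htP Finset.disjoint_sdiff
      have hsub : t₀ ∪ t ⊆ P := Finset.union_subset ht₀ (htP.trans Finset.sdiff_subset)
      have hprod : ∏ p ∈ t₀ ∪ t, p = d * ∏ p ∈ t, p := by rw [Finset.prod_union hdisj, hd]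
      refine ⟨hsub, ?_, ?_⟩
      · rw [hprod]; exact dvd_mul_right d _
      · rwa [hprod]
    · intro s hs
      rw [Finset.mem_filter, Finset.mem_powerset] at hs ⊢
      obtain ⟨hsP, hdvd, hJ⟩ := hs
      have hsprime : ∀ p ∈ s, p.Prime := fun p hp => hP p (hsP hp)
      obtain ⟨_, ht₀s⟩ := (dvd_prod_primes_iff hsprime).mp hdvd
      refine ⟨Finset.sdiff_subset_sdiff hsP le_rfl, ?_⟩
      have : d * ∏ p ∈ s \ t₀, p = ∏ p ∈ s, p := by
        rw [← hd, ← Finset.prod_union Finset.disjoint_sdiff, Finset.union_sdiff_of_subset ht₀s]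
      rwa [this]
    · intro t ht
      rw [Finset.mem_filter, Finset.mem_powerset] at ht
      have hdisj : Disjoint t₀ t := Finset.disjoint_of_subset_right ht.1 Finset.disjoint_sdiff
      exact Finset.union_sdiff_cancel_left hdisj
    · intro s hs
      rw [Finset.mem_filter, Finset.mem_powerset] at hs
      obtain ⟨hsP, hdvd, _⟩ := hs
      obtain ⟨_, ht₀s⟩ := (dvd_prod_primes_iff fun p hp => hP p (hsP hp)).mp hdvd
      exact Finset.union_sdiff_of_subset ht₀s
    · intro t ht
      rw [Finset.mem_filter, Finset.mem_powerset] at ht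
      have hdisj : Disjoint t₀ t := Finset.disjoint_of_subset_right ht.1 Finset.disjoint_sdiff
      rw [Finset.prod_union hdisj]
  · refine Finset.sum_eq_zero fun s hs => ?_
    exfalso
    rw [Finset.mem_filter, Finset.mem_powerset] at hs
    obtain ⟨hsP, hdvd, _⟩ := hs
    obtain ⟨hsq, ht₀s⟩ := (dvd_prod_primes_iff fun p hp => hP p (hsP hp)).mp hdvd
    exact h ⟨hsq, ht₀s.trans hsP⟩

/-- The map `s ↦ ∏_{p ∈ s} p` is injective on sets of primes. [folklore] -/
theorem prod_primes_injective {s t : Finset ℕ} (hs : ∀ p ∈ s, p.Prime) (ht : ∀ p ∈ t, p.Prime)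
    (h : ∏ p ∈ s, p = ∏ p ∈ t, p) : s = t := by
  rw [← Nat.primeFactors_prod hs, ← Nat.primeFactors_prod ht, h]

/-- Subsets of a set of primes containing a given prime `q` and with product in an integer window
`(a, b]` are at most as many as the multiples of `q` in that window. [folklore] -/
theorem card_powerset_filter_mem_le (P : Finset ℕ) (hP : ∀ p ∈ P, p.Prime) (q a b : ℕ) :
    ((P.powerset.filter (fun s => q ∈ s ∧ ∏ p ∈ s, p ∈ Finset.Ioc a b)).card) ≤
      ((Finset.Ioc a b).filter (fun m => q ∣ m)).card := by
  classical
  refine Finset.card_le_card_of_injOn (fun s => ∏ p ∈ s, p) (fun s hs => ?_) (fun s hs t ht hst => ?_)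
  · rw [Finset.coe_filter, Set.mem_setOf_eq, Finset.mem_powerset] at hs
    rw [Finset.coe_filter, Set.mem_setOf_eq]
    exact ⟨hs.2.2, Finset.dvd_prod_of_mem _ hs.2.1⟩
  · rw [Finset.coe_filter, Set.mem_setOf_eq, Finset.mem_powerset] at hs ht
    exact prod_primes_injective (fun p hp => hP p (hs.1 hp)) (fun p hp => hP p (ht.1 hp)) hst

end Literature.NumberTheory.Sieve.Ford2004
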